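import Summits.ResolutionOfSingularities.ResolutionOfSingularities.Theorems.FrobeniusLadderFInjectiveMacaulayficationFedderAtMaximalIdeal
import Mathlib.Algebra.Polynomial.FieldDivision
import Mathlib.Algebra.Polynomial.Degree.Domain
import Mathlib.RingTheory.PrincipalIdealDomain
import Mathlib.RingTheory.MvPolynomial.Basic
import HarnessLib

/-!
# Fedder's test uniformly along a coordinate line (general `n` and `p`)

Support file for crux stmt-ResolutionOfSingularities-15315
(`FrobeniusLadder.FInjectiveMacaulayfication`, line `Sketch`, lead seat c7): stub
`stub_fedderAlongCoordinateLine` of the §14 ENGINE package. The calibration recipe "certified one-step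
point blow-up of a hypersurface" needs, at each SINGULAR closed point of a chart `k[X]/(g)`, a
certificate that the local ring satisfies the per-stalk clause of the crux. When a chart is singular
along a whole coordinate LINE `L = V(Xⱼ : j ≠ ℓ)` of the exceptional divisor (the typical picture for
double points in characteristic `2`), the Jacobian certificate fails at every point of `L` and Fedder's
test must be run at ALL closed points of `L` — infinitely many over an infinite field, rational or not.
This file gives ONE certificate valid at every closed point of `L` simultaneously.

Let `k` be a field of characteristic `p`, `S = k[X₀, …, X_{n-1}]`, `ℓ` a coordinate, `g ∈ S`, and
`a ∈ ℕⁿ` an exponent vector with `a_ℓ = 0` and all `a_j < p`. Write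
`u(T) = Σ_t coeff_{X^a X_ℓ^t}(g^(p-1)) T^t ∈ k[T]` for the `X^a`-coefficient of `g^(p-1)` viewed in
`k[X_ℓ][Xⱼ : j ≠ ℓ]`.

* `sub_aeval_proj_mem` — for every ideal `I ∋ Xⱼ` (`j ≠ ℓ`) and every `f ∈ S`,
  `f - ψ (φ f) ∈ I`, where `φ : S → k[T]` kills `Xⱼ`, `j ≠ ℓ`, and sends `X_ℓ ↦ T`, and
  `ψ = Polynomial.aeval X_ℓ : k[T] → S` (induction on `f`).
* `exists_eq_span_of_X_mem` — STRUCTURE of the closed points of `L`: a maximal ideal `P` of `S`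
  containing all `Xⱼ`, `j ≠ ℓ`, is `P = (Xⱼ (j ≠ ℓ), ψ c)` for a non-unit `c ∈ k[T]` (a generator of
  the principal ideal `φ(P)` of the PID `k[T]`).
* `exists_extraction`, `extraction_mul_X`, `extraction_C_mul`, `extraction_mul_aeval`,
  `extraction_mul_X_pow` — the `X^a`-EXTRACTION `E : S →+ k[T]`, `(E f).coeff t = coeff_{a + t e_ℓ} f`:
  it is `k[T]`-linear (`E (f · ψ q) = E f · q`) and kills every multiple of `Xⱼ^p`, `j ≠ ℓ`
  (as `a_j < p`).
* `not_mem_span_pow` — if `u ≠ 0` has degree `< p` then `g^(p-1) ∉ (Xⱼ^p (j ≠ ℓ), (ψ c)^p)` for every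
  non-unit `c`: `E` maps that ideal into `(c^p)`, `E (g^(p-1)) = u`, and `c^p ∣ u ≠ 0` forces
  `p · deg c ≤ deg u < p`, i.e. `c` constant, i.e. (`c` non-unit) `c = 0`, i.e. `u = 0`.
* `stub_fedderAlongCoordinateLine` — the registered form: for every maximal ideal `Q` of `S/(g)`
  containing the `Xⱼ`, `j ≠ ℓ`, the local ring `(S/(g))_Q` satisfies the clause
  (`FedderAtMaximalIdeal.stub_fedderAtMaximalIdeal` with the generating family
  `j ↦ if j = ℓ then ψ c else Xⱼ` of `Q ∩ S`).

No new definitions: the maps `φ`, `ψ`, `E` enter as hypotheses `(hφ : φ = …)` / existential witnesses.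

References: [Fedder1983] R. Fedder, F-purity and rational singularity, Trans. AMS 278 (1983),
Prop. 1.7 and Thm. 1.12.
-/

-- single-problem summit: the doubled namespace component is forced
set_option linter.dupNamespace false

namespace Summit.ResolutionOfSingularities.ResolutionOfSingularities.Theorems.FInjectiveMacaulayfication.FedderAlongCoordinateLine

open MvPolynomial
open Summit.ResolutionOfSingularities.ResolutionOfSingularities.Theorems.FInjectiveMacaulayfication

section Structure

variable (k : Type) [Field k] (n : ℕ) (ℓ : Fin n)

/-- **The retraction onto `k[X_ℓ]` modulo the other variables.** Let `φ : k[X] → k[T]` be the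
`k`-algebra map `X_ℓ ↦ T`, `Xⱼ ↦ 0` (`j ≠ ℓ`) and `ψ = Polynomial.aeval X_ℓ : k[T] → k[X]`. For every
ideal `I` containing all `Xⱼ`, `j ≠ ℓ`, and every `f ∈ k[X]`: `f - ψ (φ f) ∈ I`
(induction on `f`: constants and `X_ℓ` are fixed by `ψ ∘ φ`, the other variables die in `I`). [folklore] -/
theorem sub_aeval_proj_mem (φ : MvPolynomial (Fin n) k →ₐ[k] Polynomial k)
    (hφ : φ = MvPolynomial.aeval fun j : Fin n => if j = ℓ then (Polynomial.X : Polynomial k) else 0)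
    (ψ : Polynomial k →ₐ[k] MvPolynomial (Fin n) k)
    (hψ : ψ = Polynomial.aeval (X ℓ : MvPolynomial (Fin n) k))
    (I : Ideal (MvPolynomial (Fin n) k)) (hI : ∀ j : Fin n, j ≠ ℓ → (X j : MvPolynomial (Fin n) k) ∈ I)
    (f : MvPolynomial (Fin n) k) : f - ψ (φ f) ∈ I := by
  subst hφ hψ
  induction f using MvPolynomial.induction_on with
  | C r =>
    rw [MvPolynomial.aeval_C, AlgHom.commutes, MvPolynomial.algebraMap_eq, sub_self]
    exact I.zero_mem
  | add f g hf hg =>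
    rw [map_add, map_add, add_sub_add_comm]
    exact I.add_mem hf hg
  | mul_X f j hf =>
    rw [map_mul, map_mul, MvPolynomial.aeval_X]
    by_cases hj : j = ℓ
    · rw [if_pos hj, Polynomial.aeval_X, hj, ← sub_mul]
      exact I.mul_mem_right _ hf
    · rw [if_neg hj, map_zero, mul_zero, sub_zero]
      exact I.mul_mem_left _ (hI j hj)

/-- **The closed points of a coordinate line.** A maximal ideal `P` of `k[X₀, …, X_{n-1}]` containing
all `Xⱼ`, `j ≠ ℓ`, is generated by these variables together with `c(X_ℓ)` for a NON-UNIT `c ∈ k[T]`: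
`P = (if j = ℓ then c(X_ℓ) else Xⱼ : j)`. (`c` generates the principal ideal `φ(P)` of the PID `k[T]`;
`ψ` maps `φ(P)` back into `P` and `f ≡ ψ (φ f)` modulo the `Xⱼ` by `sub_aeval_proj_mem`; `c` is not a
unit since `P ≠ ⊤`.) [folklore] -/
theorem exists_eq_span_of_X_mem (ψ : Polynomial k →ₐ[k] MvPolynomial (Fin n) k)
    (hψ : ψ = Polynomial.aeval (X ℓ : MvPolynomial (Fin n) k))
    (P : Ideal (MvPolynomial (Fin n) k)) [hP : P.IsMaximal]
    (hX : ∀ j : Fin n, j ≠ ℓ → (X j : MvPolynomial (Fin n) k) ∈ P) :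
    ∃ c : Polynomial k, ¬IsUnit c ∧
      P = Ideal.span (Set.range fun j : Fin n => if j = ℓ then ψ c else X j) := by
  obtain ⟨φ, hφ⟩ : ∃ φ : MvPolynomial (Fin n) k →ₐ[k] Polynomial k,
      φ = MvPolynomial.aeval fun j : Fin n => if j = ℓ then (Polynomial.X : Polynomial k) else 0 :=
    ⟨_, rfl⟩
  -- `ψ` maps `φ(P)` back into `P`
  have hback : ∀ y ∈ P.map φ, ψ y ∈ P := by
    intro y hy
    have h : P.map φ ≤ P.comap ψ := by
      rw [Ideal.map_le_iff_le_comap]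
      intro x hx
      rw [Ideal.mem_comap, Ideal.mem_comap]
      have h := P.sub_mem hx (sub_aeval_proj_mem k n ℓ φ hφ ψ hψ P hX x)
      rwa [sub_sub_cancel] at h
    exact Ideal.mem_comap.mp (h hy)
  -- `φ(P) = (c)` in the PID `k[T]`
  obtain ⟨c, hc⟩ : ∃ c : Polynomial k, P.map φ = Ideal.span {c} :=
    Submodule.IsPrincipal.principal (P.map φ)
  refine ⟨c, fun hu => hP.ne_top ?_, le_antisymm (fun f hf => ?_) ?_⟩
  · -- `c` a unit would put `1 = ψ 1` in `P`
    rw [Ideal.eq_top_iff_one]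
    have h1 : (1 : Polynomial k) ∈ P.map φ := by
      rw [hc, Ideal.span_singleton_eq_top.mpr hu]
      exact Submodule.mem_top
    have h := hback 1 h1
    rwa [map_one] at h
  · -- `f = (f - ψ (φ f)) + ψ q · ψ c`
    have hφf : φ f ∈ P.map φ := Ideal.mem_map_of_mem φ hf
    rw [hc] at hφf
    obtain ⟨q, hq⟩ := Ideal.mem_span_singleton'.mp hφf
    rw [← sub_add_cancel f (ψ (φ f))]
    refine Ideal.add_mem _ (sub_aeval_proj_mem k n ℓ φ hφ ψ hψ _ (fun j hj => ?_) f) ?_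
    · exact Ideal.subset_span ⟨j, if_neg hj⟩
    · rw [← hq, map_mul]
      exact Ideal.mul_mem_left _ _ (Ideal.subset_span ⟨ℓ, if_pos rfl⟩)
  · rw [Ideal.span_le]
    rintro _ ⟨j, rfl⟩
    by_cases hj : j = ℓ
    · have h : c ∈ P.map φ := by
        rw [hc]
        exact Ideal.mem_span_singleton_self c
      simpa only [hj, if_true, SetLike.mem_coe] using hback c h
    · simpa only [if_neg hj, SetLike.mem_coe] using hX j hj

end Structure

section Extraction

variable {k : Type} [Field k] {n : ℕ} {ℓ : Fin n}

/-- **The `X^a`-extraction map.** For an exponent vector `a` there is an additive map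
`E : k[X₀, …, X_{n-1}] →+ k[T]` with `(E f).coeff t = coeff_{a + t e_ℓ} f`: the coefficient of the
monomial `X^a` when `f` is viewed as a polynomial in the `Xⱼ`, `j ≠ ℓ`, over `k[X_ℓ] = k[T]`
(for `a_ℓ = 0`). (The coefficient function has finite support, contained in the image of the support
of `f`.) [folklore] -/
theorem exists_extraction (ℓ : Fin n) (a : Fin n →₀ ℕ) :
    ∃ E : MvPolynomial (Fin n) k →+ Polynomial k,
      ∀ (f : MvPolynomial (Fin n) k) (t : ℕ),
        (E f).coeff t = MvPolynomial.coeff (a + Finsupp.single ℓ t) f := by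
  classical
  have key : ∀ f : MvPolynomial (Fin n) k, ∃ u : Polynomial k,
      ∀ t : ℕ, u.coeff t = MvPolynomial.coeff (a + Finsupp.single ℓ t) f := by
    intro f
    refine ⟨Polynomial.ofFinsupp (AddMonoidAlgebra.ofCoeff (Finsupp.onFinset
      (f.support.image fun m : Fin n →₀ ℕ => m ℓ - a ℓ)
      (fun t : ℕ => MvPolynomial.coeff (a + Finsupp.single ℓ t) f) fun t ht => ?_)), fun t => ?_⟩
    · exact Finset.mem_image.mpr
        ⟨a + Finsupp.single ℓ t, MvPolynomial.mem_support_iff.mpr ht, by simp⟩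
    · simp [Finsupp.onFinset_apply]
  choose e he using key
  refine ⟨{ toFun := e, map_zero' := ?_, map_add' := fun f g => ?_ }, he⟩
  · ext t
    rw [he, MvPolynomial.coeff_zero, Polynomial.coeff_zero]
  · ext t
    rw [Polynomial.coeff_add, he, he, he, MvPolynomial.coeff_add]

variable {a : Fin n →₀ ℕ} {E : MvPolynomial (Fin n) k →+ Polynomial k}

/-- **`E` commutes with `X_ℓ ↦ T`:** `E (f · X_ℓ) = E f · T` (for `a_ℓ = 0`; the coefficient of
`X^{a + (t+1) e_ℓ}` in `f X_ℓ` is that of `X^{a + t e_ℓ}` in `f`). [folklore] -/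
theorem extraction_mul_X
    (hE : ∀ (f : MvPolynomial (Fin n) k) (t : ℕ),
      (E f).coeff t = MvPolynomial.coeff (a + Finsupp.single ℓ t) f)
    (ha : a ℓ = 0) (f : MvPolynomial (Fin n) k) :
    E (f * X ℓ) = E f * Polynomial.X := by
  classical
  ext t
  rw [hE, MvPolynomial.coeff_mul_X']
  cases t with
  | zero =>
    have h : ℓ ∉ (a + Finsupp.single ℓ 0).support := by
      simp [Finsupp.mem_support_iff, ha]
    rw [if_neg h, Polynomial.coeff_mul_X_zero]
  | succ s =>
    have h : ℓ ∈ (a + Finsupp.single ℓ (s + 1)).support := by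
      simp [Finsupp.mem_support_iff, ha]
    have h' : a + Finsupp.single ℓ (s + 1) - Finsupp.single ℓ 1 = a + Finsupp.single ℓ s := by
      ext j
      simp only [Finsupp.tsub_apply, Finsupp.add_apply, Finsupp.single_apply]
      split_ifs <;> omega
    rw [if_pos h, h', Polynomial.coeff_mul_X, hE]

/-- **`E` is `k`-linear:** `E (C r · f) = C r · E f`. [folklore] -/
theorem extraction_C_mul
    (hE : ∀ (f : MvPolynomial (Fin n) k) (t : ℕ),
      (E f).coeff t = MvPolynomial.coeff (a + Finsupp.single ℓ t) f)
    (r : k) (f : MvPolynomial (Fin n) k) :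
    E (C r * f) = Polynomial.C r * E f := by
  ext t
  rw [hE, MvPolynomial.coeff_C_mul, Polynomial.coeff_C_mul, hE]

/-- **`E` is `k[T]`-linear** along `ψ = Polynomial.aeval X_ℓ`: `E (f · ψ q) = E f · q` for every
`q ∈ k[T]` (induction on `q` from `extraction_mul_X` and `extraction_C_mul`). [folklore] -/
theorem extraction_mul_aeval
    (hE : ∀ (f : MvPolynomial (Fin n) k) (t : ℕ),
      (E f).coeff t = MvPolynomial.coeff (a + Finsupp.single ℓ t) f)
    (ha : a ℓ = 0) (ψ : Polynomial k →ₐ[k] MvPolynomial (Fin n) k)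
    (hψ : ψ = Polynomial.aeval (X ℓ : MvPolynomial (Fin n) k))
    (f : MvPolynomial (Fin n) k) (q : Polynomial k) : E (f * ψ q) = E f * q := by
  subst hψ
  induction q using Polynomial.induction_on with
  | C r =>
    rw [Polynomial.aeval_C, MvPolynomial.algebraMap_eq, mul_comm f, extraction_C_mul hE]
    exact mul_comm _ _
  | add q₁ q₂ h₁ h₂ =>
    rw [map_add, mul_add, map_add, h₁, h₂, mul_add]
  | monomial m r h =>
    rw [pow_succ, ← mul_assoc, map_mul (Polynomial.aeval (R := k) (X ℓ : MvPolynomial (Fin n) k)),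
      ← mul_assoc, Polynomial.aeval_X, extraction_mul_X hE ha, h, mul_assoc]

/-- **`E` kills the multiples of `Xⱼ^p`, `j ≠ ℓ`,** as soon as `a_j < p` (no monomial of `f · Xⱼ^p`
has `j`-exponent `a_j`). [folklore] -/
theorem extraction_mul_X_pow
    (hE : ∀ (f : MvPolynomial (Fin n) k) (t : ℕ),
      (E f).coeff t = MvPolynomial.coeff (a + Finsupp.single ℓ t) f)
    {j : Fin n} (hj : j ≠ ℓ) {p : ℕ} (hap : a j < p) (f : MvPolynomial (Fin n) k) :
    E (f * X j ^ p) = 0 := by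
  ext t
  rw [hE, MvPolynomial.X_pow_eq_monomial, MvPolynomial.coeff_mul_monomial', if_neg,
    Polynomial.coeff_zero]
  intro hle
  have h := Finsupp.single_le_iff.mp hle
  rw [Finsupp.add_apply, Finsupp.single_eq_of_ne hj, add_zero] at h
  omega

/-- **The extraction certificate.** Let `p ≥ 1`, `a_ℓ = 0`, all `a_j < p`, `c ∈ k[T]` a non-unit and
`f ∈ k[X]` such that `u(T) = Σ_t coeff_{a + t e_ℓ}(f) T^t` is a NON-ZERO polynomial of degree `< p`
(some coefficient with `t < p` is non-zero, all coefficients with `t ≥ p` vanish). Then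
`f ∉ (Xⱼ^p (j ≠ ℓ), c(X_ℓ)^p)`: the extraction `E` maps this ideal into `(c^p)` (`extraction_mul_X_pow`,
`extraction_mul_aeval`) and `E f = u`, while `c^p ∣ u ≠ 0` would give `p ≤ p · deg c ≤ deg u < p`
(`c ≠ 0` non-unit has positive degree) or `u = 0` (`c = 0`). [folklore] -/
theorem not_mem_span_pow (p : ℕ) (hp : 0 < p) (a : Fin n →₀ ℕ) (ha : a ℓ = 0)
    (hap : ∀ j : Fin n, a j < p) (ψ : Polynomial k →ₐ[k] MvPolynomial (Fin n) k)
    (hψ : ψ = Polynomial.aeval (X ℓ : MvPolynomial (Fin n) k)) (c : Polynomial k) (hc : ¬IsUnit c)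
    (f : MvPolynomial (Fin n) k)
    (h1 : ∃ t : ℕ, t < p ∧ MvPolynomial.coeff (a + Finsupp.single ℓ t) f ≠ 0)
    (h2 : ∀ t : ℕ, p ≤ t → MvPolynomial.coeff (a + Finsupp.single ℓ t) f = 0) :
    f ∉ Ideal.span (Set.range fun j : Fin n => (if j = ℓ then ψ c else X j) ^ p) := by
  classical
  intro hmem
  obtain ⟨E, hE⟩ := exists_extraction (k := k) ℓ a
  -- `u = E f` is non-zero of degree `< p`
  obtain ⟨t₀, -, ht₀⟩ := h1
  have hu0 : E f ≠ 0 := by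
    intro h
    apply ht₀
    rw [← hE, h, Polynomial.coeff_zero]
  have hdeg : (E f).natDegree < p := by
    rw [Polynomial.natDegree_lt_iff_degree_lt hu0, Polynomial.degree_lt_iff_coeff_zero]
    intro m hm
    rw [hE]
    exact h2 m hm
  -- `E` maps the ideal into `(c^p)`: `E f = E (h ℓ) · c^p`
  obtain ⟨h, hh⟩ := Ideal.mem_span_range_iff_exists_fun.mp hmem
  have hEf : E f = E (h ℓ) * c ^ p := by
    rw [← hh, map_sum, Finset.sum_eq_single ℓ]
    · rw [if_pos rfl, ← map_pow, extraction_mul_aeval hE ha ψ hψ]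
    · intro j _ hj
      rw [if_neg hj, extraction_mul_X_pow hE hj (hap j)]
    · intro h
      exact absurd (Finset.mem_univ ℓ) h
  -- degree count
  by_cases hc0 : c = 0
  · apply hu0
    rw [hEf, hc0, zero_pow hp.ne', mul_zero]
  · have hcdeg : 0 < c.natDegree :=
      Polynomial.natDegree_pos_iff_degree_pos.mpr
        (Polynomial.degree_pos_of_ne_zero_of_nonunit hc0 hc)
    have hdvd : c ^ p ∣ E f := ⟨E (h ℓ), by rw [hEf, mul_comm]⟩
    have hle := Polynomial.natDegree_le_of_dvd hdvd hu0
    rw [Polynomial.natDegree_pow] at hle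
    have hle' := Nat.le_mul_of_pos_right p hcdeg
    omega

end Extraction

/-! ## Registered form -/

/-- **FEDDER ALONG A COORDINATE LINE — UNIFORMLY IN THE CLOSED POINT** (stub
`stub_fedderAlongCoordinateLine` of line `Sketch`; general `n`, `p`; the discharger for a singular LINE
on the exceptional divisor, where the Jacobian certificate fails at every point and the closed points
are infinitely many over an infinite `k`): let `k` be a field of characteristic `p`, `ℓ` a coordinate
of `k[X₀, …, X_{n-1}]`, `g ∈ k[X]`, and `Q` ANY maximal ideal of `k[X]/(g)` containing all `Xⱼ`,
`j ≠ ℓ` (a closed point of the line `L = V(Xⱼ : j ≠ ℓ)`, rational or not). If some monomial `X^a` in the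
variables `j ≠ ℓ` with all exponents `< p` has, as its coefficient in `g^(p-1)` viewed in
`k[X_ℓ][Xⱼ : j ≠ ℓ]`, a NON-ZERO polynomial `u(X_ℓ)` of degree `< p`, then `(k[X]/(g))_Q` satisfies the
per-stalk clause of `FrobeniusLadder.FInjectiveMacaulayfication`: every system of parameters is weakly
regular and generates a Frobenius closed ideal. (The contraction of `Q` is `(Xⱼ (j ≠ ℓ), c(X_ℓ))` for a
non-unit `c` — `exists_eq_span_of_X_mem`; by `FedderAtMaximalIdeal.stub_fedderAtMaximalIdeal` it
suffices that `g^(p-1) ∉ (Xⱼ^p (j ≠ ℓ), c(X_ℓ)^p)`, which is `not_mem_span_pow`.)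
[cite: Fedder1983, Prop. 1.7 and Thm. 1.12] -/
theorem stub_fedderAlongCoordinateLine : ∀ (p : ℕ) [Fact p.Prime] (k : Type) [Field k] [CharP k p] (n : ℕ) (ℓ : Fin n)
    (g : MvPolynomial (Fin n) k) (a : Fin n →₀ ℕ),
    a ℓ = 0 → (∀ j : Fin n, a j < p) →
    (∃ t : ℕ, t < p ∧ MvPolynomial.coeff (a + Finsupp.single ℓ t) (g ^ (p - 1)) ≠ 0) →
    (∀ t : ℕ, p ≤ t → MvPolynomial.coeff (a + Finsupp.single ℓ t) (g ^ (p - 1)) = 0) →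
    ∀ (Q : Ideal (MvPolynomial (Fin n) k ⧸ Ideal.span {g})) [Q.IsMaximal],
    (∀ j : Fin n, j ≠ ℓ → Ideal.Quotient.mk (Ideal.span {g}) (MvPolynomial.X j) ∈ Q) →
    ∀ d : ℕ, ringKrullDim (Localization.AtPrime Q) = d → ∀ s : Fin d → Localization.AtPrime Q,
      (Ideal.span (Set.range s)).radical.IsMaximal →
        RingTheory.Sequence.IsWeaklyRegular (Localization.AtPrime Q) (List.ofFn s) ∧
        ∀ y : Localization.AtPrime Q, (∃ e : ℕ, y ^ p ^ e ∈ Ideal.span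
          ((fun z : Localization.AtPrime Q => z ^ p ^ e) ''
            (Ideal.span (Set.range s) : Set (Localization.AtPrime Q)))) → y ∈ Ideal.span (Set.range s) := by
  intro p _ k _ _ n ℓ g a ha hap h1 h2 Q _ hXQ
  -- `P = Q ∩ S` is a maximal ideal of `S` containing the `Xⱼ`, `j ≠ ℓ`
  haveI hPmax : (Q.comap (Ideal.Quotient.mk (Ideal.span {g}))).IsMaximal :=
    Ideal.comap_isMaximal_of_surjective _ Ideal.Quotient.mk_surjective
  have hXP : ∀ j : Fin n, j ≠ ℓ →
      (X j : MvPolynomial (Fin n) k) ∈ Q.comap (Ideal.Quotient.mk (Ideal.span {g})) :=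
    fun j hj => Ideal.mem_comap.mpr (hXQ j hj)
  -- `P = (Xⱼ (j ≠ ℓ), c(X_ℓ))` for a non-unit `c ∈ k[T]`
  obtain ⟨c, hcu, hP⟩ := exists_eq_span_of_X_mem k n ℓ (Polynomial.aeval (X ℓ : MvPolynomial (Fin n) k))
    rfl (Q.comap (Ideal.Quotient.mk (Ideal.span {g}))) hXP
  have hp : 0 < p := (Fact.out : p.Prime).pos
  -- `g ≠ 0`: `g^(p-1)` has a non-zero coefficient
  have hg0 : g ≠ 0 := by
    rintro rfl
    obtain ⟨t, -, ht⟩ := h1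
    have hp1 : p - 1 ≠ 0 := by
      have h2le := (Fact.out : p.Prime).two_le
      omega
    exact ht (by rw [zero_pow hp1, MvPolynomial.coeff_zero])
  -- Fedder's test at `P` through the generating family `j ↦ if j = ℓ then c(X_ℓ) else Xⱼ`
  have hfed := not_mem_span_pow p hp a ha hap (Polynomial.aeval (X ℓ : MvPolynomial (Fin n) k)) rfl
    c hcu (g ^ (p - 1)) h1 h2
  have key := FedderAtMaximalIdeal.stub_fedderAtMaximalIdeal p k n n
    (fun j : Fin n => if j = ℓ then Polynomial.aeval (X ℓ : MvPolynomial (Fin n) k) c else X j)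
    g Q hP hg0 hfed
  exact key

end Summit.ResolutionOfSingularities.ResolutionOfSingularities.Theorems.FInjectiveMacaulayfication.FedderAlongCoordinateLine
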